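import Summits.ValiantsHypothesis.ValiantsHypothesis.Theorems.TwoProducts.RankThreeAffineUnitLadder

/-!
# Rung 3-AFF, the OLM slot: the COLUMN LADDER — `K` u-free monomial columns are tame UNIFORMLY in the column heights

OLM slot (val-idea-crit-8 g5 VERDICT #82 (b)/#83/#85; `OLMLaw` itself is typed by val-idea-35 g11 in the Cruxes workfile and is NOT restated here):
`F = P(x, y, u)` with `P : Poly3` and ONE `t`-sparse letter `u`.  Grouping `P` by its u-FREE part, `F = Σ_{c ∈ cols} X^c · ψ_c(u)` with `ψ_c ∈ ℂ[U]`
the COLUMN polynomials (of degree ≤ the u-degree `k` of `P`).  THIS FILE: for every number `K` of columns, `nv F ≤ colBound K t = t^{O(5^K)}`, with NO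
hypothesis on the columns `ψ_c` (any degrees, any coefficients) nor on the exponents `c` (repeated / resonant allowed) — the u-degree `k` never enters.

MECHANISM.  `D := J(·,u)` is a derivation whose constants contain ℂ[u] (✓ `jac_aeval_self`, val-port-1 g5), so for a column sum `N = Σ_{k∈K} Φ_k·ψ_k(u)`
and a pivot `p ∈ K`:  `Φ_p·J(N,u) − N·J(Φ_p,u) = Σ_{k≠p} newCol(Φ_p,Φ_k)·ψ_k(u)`,  `newCol(Φ_p,Φ_k) := Φ_p·J(Φ_k,u) − Φ_k·J(Φ_p,u)` (★ `column_step_identity`):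
the columns `ψ_k(u)` are UNTOUCHED, only the column FUNCTIONS are replaced by 2-Wronskians.  One application of val-port-1 g5's ✓ shifted template
`Eset_subset_of_shifted` (`v := u`, `G := Φ_p`, `M := 1`, `F' := 1`, `Br := N'`) per column (★ `card_Eset_column_step_le`, where the RESIDUE TERM
`|Eset σ Φ_p|` of the pivot column function is a visible summand), and after `|K|` steps nothing is left (★★ `card_Eset_columnSum_le`, structural recursion
on the number of columns with the column functions and their sparsity universally quantified; the residue is crushed only there, by ✓ `card_Eset_le_sq`
and the support recursion `s ↦ 2s²t`, ★ `card_support_newCol_le`).  Contrast: ✓ `card_Eset_unitSum_le` (the unit ladder of T1-E / (B1)) pivots on `U_p·C_p`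
and squares the SPARSITY OF THE COEFFICIENTS at each step — that is where `(mt)^{O(2^k)}` comes from; here the coefficients are `J(·,u)`-constants and the
price `t^{O(5^K)}` is paid in `K` only.
HEADLINES: ★★ `olmColumns_nv_le (K t) (u) (hu) (e : Fin K → Expo) (ψ : Fin K → Polynomial ℂ) : nv (∑ i, monomial (e i) 1 * Polynomial.aeval u (ψ i)) ≤ colBound K t`
(any `Finset`: `columnSum_nv_le`); the OLM-explicit form ★ `olm_nv_le_of_columns` (`nv (MvPolynomial.aeval ![X 0, X 1, u] P) ≤ colBound K t` when the u-free
projections `single 0 (s 0) + single 1 (s 1)` of `supp P` lie in `≤ K` columns; `aeval_olm_eq_columnSum`); the two-column line `colBound_two` /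
★ `olmTwoColumns_nv_le` (`nv (X^{e₁}ψ₁(u) + X^{e₂}ψ₂(u)) ≤ 36t² + 12t + 22`, resonant `e₂ − e₁ ∥ pivot` included); the readable currency `colLadder_le_pow` /
★ `olmColumnsLaw` (`∀ K, ∃ c, ∀ t u e ψ, nv ≤ (t+2)^c`, `c = 2·colExp K + 3`, `colExp (n+1) = 5·colExp n + 5`).
PRINT LINE (val-idea-crit-8 g5 #85 (L6), wording theirs).  «Wronskian elimination with respect to the derivation `D = J(·,u)`, whose field of constants contains
`ℂ(u)` — the generalized-Wronskian criterion over the constants of a derivation (Bostan–Dumas, «Wronskians and linear independence», Amer. Math. Monthly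
117 (2010) 722–727, doi 10.4169/000298910x515785; Koiran–Portier–Tavenas, arXiv:1205.1015 §2, for `d/dx`) with `d/dx` replaced by `J(·,u)` and Rolle replaced by
the ✓ shifted axial transfer; novelty grade VARIANT (the constants-of-`D` choice is the one non-print move and is what makes the bound uniform in the column
heights).»
READING (with val-port-1 g5's (B1) «fixed u-degree k: (mt)^{O(2^k)}», ✓-pending `…RankThreeAffineOLMSlices`): in the OLM slot neither a bounded u-degree NOR a
bounded number of u-free columns escapes; the residue of `OLMLaw` is «K and k BOTH growing with m», and in this ladder it is carried ONLY by the ψ-FREE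
iterated toric brackets `Φ^{(j)}` of the monomials against `u` ((TW-count) of the scratch report 44e1e76fa8779622; stall = merged resonances).
HONEST LABEL: helper / located class of the OPEN rung 3-AFF (side ladder «table-rank-ladder», crux `stmt-ValiantsHypothesis-5906` `TwoProducts`); NOT γ;
`RankThreeAffineLaw(Exp)` / `OLMLaw` / `LevelOneLaw` / `TwoProducts` / PCB / `ResidualLawV25` UNMOVED; 0 summit distance; VP ≠ VNP is NOT proved.
`--kind definition --supports stmt-ValiantsHypothesis-5906 --as helper` (val-port-4 g5; critic of record val-idea-crit-8 g5).  Vocabulary by import of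
✓ `…RankThreeAffineUnitLadder` (transitively ✓ `…ShiftedSpecials`, ✓ `…RankThreeAffineUnivariate`, ✓ `…RankThreeAffineTrinomial`); no instances, no notation,
no named facts. [folklore]
-/

noncomputable section
set_option linter.dupNamespace false

namespace Summit.ValiantsHypothesis.ValiantsHypothesis.Theorems.TwoProducts.RankTwoJacobian

open scoped BigOperators Pointwise
open MvPolynomial

section TowerKernel
open scoped Classical

/-! ### §1 `J(·,u)` kills univariate compositions (✓ `jac_aeval_self`, val-port-1 g5), so the columns are `J(·,u)`-constants -/

/-- `J(Φ·ψ(u), u) = J(Φ, u)·ψ(u)` (✓ `jac_mul_left` + ✓ `jac_aeval_self`). [folklore] -/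
theorem jac_mul_aeval_self (u Φ : Poly2) (ψ : Polynomial ℂ) :
    jac (Φ * Polynomial.aeval u ψ) u = jac Φ u * Polynomial.aeval u ψ := by
  rw [jac_mul_left, jac_aeval_self, mul_zero, zero_add, mul_comm]

/-! ### §2 The column step (engine, abstract column functions) -/

/-- the NEW COLUMN FUNCTION after pivoting on `Φp`: the 2-Wronskian `Φp·J(Φi,u) − Φi·J(Φp,u)`. -/
def newCol (u Φp Φi : Poly2) : Poly2 := Φp * jac Φi u - Φi * jac Φp u

/-- `|supp newCol| ≤ 2s²t` when `u` has `≤ t` monomials and both column functions have `≤ s`. [folklore] -/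
theorem card_support_newCol_le {u Φp Φi : Poly2} {t s : ℕ} (hut : u.support.card ≤ t) (hp : Φp.support.card ≤ s)
    (hi : Φi.support.card ≤ s) : (newCol u Φp Φi).support.card ≤ 2 * s * s * t := by
  unfold newCol
  have h1 : (Φp * jac Φi u).support.card ≤ s * (s * t) :=
    (card_supp_mul_le _ _).trans (Nat.mul_le_mul hp ((card_support_jac_le Φi u).trans (Nat.mul_le_mul hi hut)))
  have h2 : (Φi * jac Φp u).support.card ≤ s * (s * t) :=
    (card_supp_mul_le _ _).trans (Nat.mul_le_mul hi ((card_support_jac_le Φp u).trans (Nat.mul_le_mul hp hut)))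
  calc (Φp * jac Φi u - Φi * jac Φp u).support.card ≤ s * (s * t) + s * (s * t) := (card_supp_sub_le _ _).trans (Nat.add_le_add h1 h2)
    _ = 2 * s * s * t := by ring

/-- ★ COLUMN STEP IDENTITY: `Φ_p·J(N,u) − N·J(Φ_p,u) = Σ_{k≠p} newCol(Φ_p,Φ_k)·ψ_k(u)` for `N = Σ_k Φ_k·ψ_k(u)` — the columns `ψ_k(u)` are
`J(·,u)`-constants and pass through untouched. -/
theorem column_step_identity {ι : Type*} [DecidableEq ι] (K : Finset ι) (Φ : ι → Poly2) (ψ : ι → Polynomial ℂ) (u : Poly2) (p : ι) (hp : p ∈ K) :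
    Φ p * jac (∑ k ∈ K, Φ k * Polynomial.aeval u (ψ k)) u - (∑ k ∈ K, Φ k * Polynomial.aeval u (ψ k)) * jac (Φ p) u =
      ∑ k ∈ K.erase p, newCol u (Φ p) (Φ k) * Polynomial.aeval u (ψ k) := by
  rw [jac_sum_left]
  simp_rw [jac_mul_aeval_self]
  have h : Φ p * ∑ k ∈ K, jac (Φ k) u * Polynomial.aeval u (ψ k) - (∑ k ∈ K, Φ k * Polynomial.aeval u (ψ k)) * jac (Φ p) u =
      ∑ k ∈ K, newCol u (Φ p) (Φ k) * Polynomial.aeval u (ψ k) := by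
    rw [Finset.mul_sum, Finset.sum_mul, ← Finset.sum_sub_distrib]
    refine Finset.sum_congr rfl fun k _ => ?_
    unfold newCol; ring
  rw [h, ← Finset.add_sum_erase _ _ hp]
  unfold newCol
  rw [sub_self, zero_mul, zero_add]

/-- ★ ONE COLUMN STEP (✓ `Eset_subset_of_shifted` with `v := u`, `G := Φ_p`, `M := 1`, `F' := 1`): with the RESIDUE TERM `|Eset σ Φ_p|` of the pivot
column function VISIBLE,  `|Eset σ N| ≤ 3|Xc σ u| + 3|Eset σ Φ_p| + 3 + |Eset σ N'|`,  `N' = Σ_{k≠p} newCol(Φ_p,Φ_k)·ψ_k(u)`. -/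
theorem card_Eset_column_step_le {σ : ℝ} (hσ : σ = 1 ∨ σ = -1) {ι : Type*} [DecidableEq ι] {u : Poly2} (hS : (S1 u).Nonempty) (K : Finset ι)
    (Φ : ι → Poly2) (ψ : ι → Polynomial ℂ) {p : ι} (hp : p ∈ K) (hp0 : Φ p ≠ 0) :
    (Eset σ (∑ k ∈ K, Φ k * Polynomial.aeval u (ψ k))).card ≤
      3 * (Xc σ u).card + 3 * (Eset σ (Φ p)).card + 3 +
        (Eset σ (∑ k ∈ K.erase p, newCol u (Φ p) (Φ k) * Polynomial.aeval u (ψ k))).card := by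
  set N := ∑ k ∈ K, Φ k * Polynomial.aeval u (ψ k) with hN
  set N' := ∑ k ∈ K.erase p, newCol u (Φ p) (Φ k) * Polynomial.aeval u (ψ k) with hN'
  have hid : (1 : Poly2) * (Φ p * jac N u - N * jac (Φ p) u) = 1 * N' := by
    rw [one_mul, one_mul, hN, hN', column_step_identity K Φ ψ u p hp]
  have hsub := Eset_subset_of_shifted hσ hS hp0 one_ne_zero hid
  have hSS := card_SpecShift_le' hσ u (Φ p) N
  have h1 : (Eset σ (1 : Poly2)).card ≤ 1 := by
    refine (card_Eset_le σ 1).trans ?_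
    have : (1 : Poly2).support.card ≤ 1 := by
      have hs : (1 : Poly2).support ⊆ {0} := by
        rw [← C_1, C_apply]; exact support_monomial_subset
      exact (Finset.card_le_card hs).trans (by simp)
    exact Nat.mul_le_mul this this
  calc (Eset σ N).card
      ≤ (Xc σ u ∪ Eset σ (Φ p) ∪ SpecShift σ u (Φ p) N ∪ (Eset σ 1 ∪ Eset σ N')).card := Finset.card_le_card hsub
    _ ≤ (Xc σ u).card + (Eset σ (Φ p)).card + (SpecShift σ u (Φ p) N).card + ((Eset σ (1 : Poly2)).card + (Eset σ N').card) := by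
        refine (Finset.card_union_le _ _).trans (Nat.add_le_add ?_ (Finset.card_union_le _ _))
        refine (Finset.card_union_le _ _).trans (Nat.add_le_add_right ?_ _)
        exact Finset.card_union_le _ _
    _ ≤ 3 * (Xc σ u).card + 3 * (Eset σ (Φ p)).card + 3 + (Eset σ N').card := by omega

/-! ### §3 The column ladder -/

/-- the ladder function: `colLadder t 0 s = 0`, `colLadder t (n+1) s = 3(t²+t) + 3s² + 3 + colLadder t n (2s²t)` — one column step with the residue
term `|Eset σ Φ_p|` crushed to `s²` (✓ `card_Eset_le_sq`), then the remaining columns with the squared support bound. -/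
def colLadder (t : ℕ) : ℕ → ℕ → ℕ
  | 0, _ => 0
  | n + 1, s => 3 * (t * t + t) + 3 * (s * s) + 3 + colLadder t n (2 * s * s * t)

/-- ★★ THE COLUMN LADDER: for a non-constant `t`-sparse `u`, ANY univariate columns `ψ_k` and column functions `Φ_k` with `≤ s` monomials,
`|Eset σ (Σ_{k∈K} Φ_k·ψ_k(u))| ≤ colLadder t |K| s` — the columns `ψ_k` do not enter the bound (structural recursion on the number of columns, the column
functions and their sparsity universally quantified). -/
theorem card_Eset_columnSum_le {σ : ℝ} (hσ : σ = 1 ∨ σ = -1) {ι : Type*} [DecidableEq ι] {u : Poly2} {t : ℕ} (hS : (S1 u).Nonempty)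
    (hut : u.support.card ≤ t) (ψ : ι → Polynomial ℂ) :
    ∀ (n : ℕ) (K : Finset ι) (Φ : ι → Poly2) (s : ℕ), K.card ≤ n → (∀ k ∈ K, (Φ k).support.card ≤ s) →
      (Eset σ (∑ k ∈ K, Φ k * Polynomial.aeval u (ψ k))).card ≤ colLadder t n s := by
  intro n
  induction n with
  | zero =>
    intro K Φ s hK _
    rw [Finset.card_eq_zero.mp (Nat.le_zero.mp hK), Finset.sum_empty, Eset_zero]
    simp [colLadder]
  | succ n ih =>
    intro K Φ s hK hΦ
    by_cases hpiv : ∃ p ∈ K, Φ p ≠ 0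
    · obtain ⟨p, hp, hp0⟩ := hpiv
      have hstep := card_Eset_column_step_le hσ hS K Φ ψ hp hp0
      have hX : (Xc σ u).card ≤ t * t + t := (card_Xc_le σ u).trans (Nat.add_le_add (Nat.mul_le_mul hut hut) hut)
      have hG : (Eset σ (Φ p)).card ≤ s * s := card_Eset_le_sq σ (Φ p) (hΦ p hp)
      have hN' : (Eset σ (∑ k ∈ K.erase p, newCol u (Φ p) (Φ k) * Polynomial.aeval u (ψ k))).card ≤ colLadder t n (2 * s * s * t) := by
        refine ih (K.erase p) (fun k => newCol u (Φ p) (Φ k)) (2 * s * s * t) ?_ ?_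
        · rw [Finset.card_erase_of_mem hp]; omega
        · intro k hk
          exact card_support_newCol_le hut (hΦ p hp) (hΦ k (Finset.mem_of_mem_erase hk))
      calc (Eset σ (∑ k ∈ K, Φ k * Polynomial.aeval u (ψ k))).card
          ≤ 3 * (Xc σ u).card + 3 * (Eset σ (Φ p)).card + 3 +
              (Eset σ (∑ k ∈ K.erase p, newCol u (Φ p) (Φ k) * Polynomial.aeval u (ψ k))).card := hstep
        _ ≤ 3 * (t * t + t) + 3 * (s * s) + 3 + colLadder t n (2 * s * s * t) := by omega
        _ = colLadder t (n + 1) s := by simp only [colLadder]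
    · -- no non-zero column function: the sum vanishes
      push Not at hpiv
      have h0 : ∑ k ∈ K, Φ k * Polynomial.aeval u (ψ k) = 0 :=
        Finset.sum_eq_zero fun k hk => by rw [hpiv k hk, zero_mul]
      rw [h0, Eset_zero]; simp

/-- the ladder dominates `3n` (used in the constant-carrier corner). [folklore] -/
theorem le_colLadder (t : ℕ) : ∀ n s : ℕ, 3 * n ≤ colLadder t n s
  | 0, _ => by simp [colLadder]
  | n + 1, s => by
    have := le_colLadder t n (2 * s * s * t)
    simp only [colLadder]; omega

/-- THE COLUMN BOUND for `K` columns (two charts + 4, ✓ `nv_le`): `colBound K t = 2·colLadder t K 1 + 4` — explicit, computable, `t^{O(5^K)}`. -/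
def colBound (K t : ℕ) : ℕ := 2 * colLadder t K 1 + 4

/-- support of a sum of `|I|` weighted monomials has `≤ |I|` points. [folklore] -/
theorem card_support_sum_monomial_le {ι : Type*} (I : Finset ι) (e : ι → Expo) (a : ι → ℂ) :
    (∑ i ∈ I, (monomial (e i) (a i) : Poly2)).support.card ≤ I.card := by
  refine (Finset.card_le_card (support_sum)).trans ((Finset.card_biUnion_le).trans ?_)
  have : ∀ i ∈ I, ((monomial (e i) (a i) : Poly2)).support.card ≤ 1 := fun i _ =>
    (Finset.card_le_card support_monomial_subset).trans (by simp)
  exact (Finset.sum_le_sum this).trans (by simp)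

/-- ★★ MONOMIAL COLUMNS over any index set: for `u` with `≤ t` monomials, ANY exponents `e_i` and ANY univariate columns `ψ_i` (`|I| ≤ K`),
`nv (Σ_{i∈I} X^{e_i}·ψ_i(u)) ≤ colBound K t` — no hypothesis on the `e_i` (repeated or resonant allowed) or on the `ψ_i` (degrees free). -/
theorem columnSum_nv_le {ι : Type*} (K t : ℕ) (u : Poly2) (hu : u.support.card ≤ t) (I : Finset ι) (hI : I.card ≤ K)
    (e : ι → Expo) (ψ : ι → Polynomial ℂ) :
    nv (∑ i ∈ I, monomial (e i) (1 : ℂ) * Polynomial.aeval u (ψ i)) ≤ colBound K t := by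
  unfold colBound
  by_cases hS : (S1 u).Nonempty
  · have hmono : ∀ i ∈ I, ((monomial (e i) (1 : ℂ) : Poly2)).support.card ≤ 1 := fun i _ =>
      (Finset.card_le_card support_monomial_subset).trans (by simp)
    have h1 := card_Eset_columnSum_le (σ := 1) (Or.inl rfl) hS hu ψ K I (fun i => monomial (e i) 1) 1 hI hmono
    have h2 := card_Eset_columnSum_le (σ := -1) (Or.inr rfl) hS hu ψ K I (fun i => monomial (e i) 1) 1 hI hmono
    have hn := nv_le (∑ i ∈ I, monomial (e i) (1 : ℂ) * Polynomial.aeval u (ψ i))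
    omega
  · -- constant carrier: the sum is `Σ_i ψ_i(c)·X^{e_i}`, at most `|I| ≤ K` monomials
    have huC : u = C (coeff 0 u) := eq_C_of_S1_empty hS
    have hval : ∀ i, Polynomial.aeval u (ψ i) = C ((ψ i).eval (coeff 0 u)) := fun i => by
      rw [show Polynomial.aeval u (ψ i) = Polynomial.aeval (C (coeff 0 u) : Poly2) (ψ i) by rw [← huC]]
      exact aeval_C_eq _ _
    have hsum : ∑ i ∈ I, monomial (e i) (1 : ℂ) * Polynomial.aeval u (ψ i) =
        ∑ i ∈ I, (monomial (e i) ((ψ i).eval (coeff 0 u)) : Poly2) := by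
      refine Finset.sum_congr rfl fun i _ => ?_
      rw [hval i, mul_comm, C_mul_monomial, mul_one]
    rw [hsum]
    have hK := (nv_le_card_support _).trans
      ((card_support_sum_monomial_le I e (fun i => (ψ i).eval (coeff 0 u))).trans hI)
    have := le_colLadder t K 1
    omega

/-- ★★ **`K` u-FREE COLUMNS, k-UNIFORM** (the headline, crit-8 #85 (L1) verbatim): for `u` with `≤ t` monomials and ANY `e : Fin K → Expo`,
`ψ : Fin K → ℂ[X]`:  `nv (Σ_i X^{e_i}·ψ_i(u)) ≤ colBound K t`. -/
theorem olmColumns_nv_le (K t : ℕ) (u : Poly2) (hu : u.support.card ≤ t) (e : Fin K → Expo) (ψ : Fin K → Polynomial ℂ) :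
    nv (∑ i, monomial (e i) 1 * Polynomial.aeval u (ψ i)) ≤ colBound K t :=
  columnSum_nv_le K t u hu Finset.univ (by simp) e ψ

/-- `colBound 2 t = 36t² + 12t + 22` (what the ladder evaluates to for two columns; not hand-tuned, crit-8 #85 (L4)). [folklore] -/
theorem colBound_two (t : ℕ) : colBound 2 t = 36 * (t * t) + 12 * t + 22 := by
  simp only [colBound, colLadder]; ring

/-- ★ THE TWO-COLUMN LINE: `nv (X^{e₁}·ψ₁(u) + X^{e₂}·ψ₂(u)) ≤ 36t² + 12t + 22` for ALL `e₁, e₂, ψ₁, ψ₂` (the resonant case `e₂ − e₁ ∥ pivot` included). -/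
theorem olmTwoColumns_nv_le (t : ℕ) (u : Poly2) (hu : u.support.card ≤ t) (e₁ e₂ : Expo) (ψ₁ ψ₂ : Polynomial ℂ) :
    nv (monomial e₁ (1 : ℂ) * Polynomial.aeval u ψ₁ + monomial e₂ (1 : ℂ) * Polynomial.aeval u ψ₂) ≤ 36 * (t * t) + 12 * t + 22 := by
  have h := olmColumns_nv_le 2 t u hu ![e₁, e₂] ![ψ₁, ψ₂]
  rw [Fin.sum_univ_two, colBound_two] at h
  simpa using h

/-! ### §4 The OLM-explicit form: `P(x, y, u)` whose u-free projections lie in `K` columns -/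

/-- the u-free projection of a trivariate exponent: `(s₀, s₁, s₂) ↦ (s₀, s₁)`. -/
def ufree (s : Fin 3 →₀ ℕ) : Expo := Finsupp.single 0 (s 0) + Finsupp.single 1 (s 1)

/-- the column polynomial of `P` above the u-free exponent `c`: `ψ_c(U) = Σ_{s : ufree s = c} P_s U^{s₂}`. -/
def colPoly (P : Poly3) (c : Expo) : Polynomial ℂ :=
  ∑ s ∈ P.support.filter (fun s => ufree s = c), Polynomial.monomial (s 2) (coeff s P)

/-- evaluation of one monomial of `P` in the OLM slot: `X₀^{s₀} X₁^{s₁} u^{s₂} = X^{ufree s} · u^{s₂}`. [folklore] -/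
theorem aeval_olm_monomial_ufree (u : Poly2) (s : Fin 3 →₀ ℕ) (a : ℂ) :
    MvPolynomial.aeval ![(X 0 : Poly2), X 1, u] (monomial s a) = monomial (ufree s) (1 : ℂ) * (C a * u ^ (s 2)) := by
  rw [aeval_monomial, MvPolynomial.algebraMap_eq, Finsupp.prod_fintype _ _ (fun i => by exact pow_zero _)]
  simp only [Fin.prod_univ_three, Matrix.cons_val_zero, Matrix.cons_val_one, Matrix.cons_val]
  have hm : (monomial (ufree s) (1 : ℂ) : Poly2) = X 0 ^ (s 0) * X 1 ^ (s 1) := by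
    unfold ufree
    rw [X_pow_eq_monomial, X_pow_eq_monomial, monomial_mul, one_mul]
  rw [hm]; ring

/-- ★ GROUPING BY COLUMNS: if the u-free projections of `supp P` lie in `cols`, then `P(x,y,u) = Σ_{c∈cols} X^c · ψ_c(u)`. -/
theorem aeval_olm_eq_columnSum (u : Poly2) (P : Poly3) (cols : Finset Expo) (hP : ∀ s ∈ P.support, ufree s ∈ cols) :
    MvPolynomial.aeval ![(X 0 : Poly2), X 1, u] P = ∑ c ∈ cols, monomial c (1 : ℂ) * Polynomial.aeval u (colPoly P c) := by
  conv_lhs => rw [P.as_sum, map_sum]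
  rw [← Finset.sum_fiberwise_of_maps_to (g := ufree) (fun s hs => hP s hs)]
  refine Finset.sum_congr rfl fun c _ => ?_
  unfold colPoly
  rw [map_sum, Finset.mul_sum]
  refine Finset.sum_congr rfl fun s hs => ?_
  obtain ⟨-, hsc⟩ := Finset.mem_filter.mp hs
  rw [aeval_olm_monomial_ufree, Polynomial.aeval_monomial, MvPolynomial.algebraMap_eq, hsc]

/-- ★ **THE OLM-EXPLICIT COLUMN BOUND.** If the u-free projections `single 0 (s 0) + single 1 (s 1)` of `supp P` lie in a set of `≤ K` columns, then
`nv (P(x,y,u)) ≤ colBound K t` for every `u` with `≤ t` monomials — uniformly in the u-degree of `P` and in everything else. -/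
theorem olm_nv_le_of_columns (K t : ℕ) (u : Poly2) (hu : u.support.card ≤ t) (P : Poly3) (cols : Finset Expo) (hK : cols.card ≤ K)
    (hP : ∀ s ∈ P.support, Finsupp.single 0 (s 0) + Finsupp.single 1 (s 1) ∈ cols) :
    nv (MvPolynomial.aeval ![(X 0 : Poly2), X 1, u] P) ≤ colBound K t := by
  rw [aeval_olm_eq_columnSum u P cols hP]
  exact columnSum_nv_le K t u hu cols hK (fun c => c) (colPoly P)

/-! ### §5 Readable currency: `colLadder t K 1 ≤ (t+3)^(colExp K)`, hence `nv ≤ (t+2)^(2·colExp K + 3)` for every FIXED `K` -/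

/-- the exponent recursion: `colExp 0 = 0`, `colExp (n+1) = 5·colExp n + 5` (so the bound is `t^{O(5^K)}` — honest about the blow-up in `K`). -/
def colExp : ℕ → ℕ
  | 0 => 0
  | n + 1 => 5 * colExp n + 5

/-- one step of the arithmetic: with `Y = t + s + 2`, `3(t²+t) + 3s² + 3 ≤ Y⁴` and `t + 2s²t + 2 ≤ Y⁵`. [folklore] -/
theorem col_arith_step (t s : ℕ) :
    3 * (t * t + t) + 3 * (s * s) + 3 ≤ (t + s + 2) ^ 4 ∧ t + 2 * s * s * t + 2 ≤ (t + s + 2) ^ 5 := by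
  set Y := t + s + 2 with hY
  have hY2 : 2 ≤ Y := by omega
  have ht : t ≤ Y := by omega
  have hs : s ≤ Y := by omega
  constructor
  · have h1 : 3 * (t * t + t) + 3 * (s * s) + 3 ≤ 3 * (Y * Y) := by rw [hY]; nlinarith
    have h2 : 3 * (Y * Y) ≤ Y ^ 4 := by
      have : 3 ≤ Y * Y := by nlinarith
      calc 3 * (Y * Y) ≤ (Y * Y) * (Y * Y) := Nat.mul_le_mul_right _ this
        _ = Y ^ 4 := by ring
    exact h1.trans h2
  · have h1 : t + 2 * s * s * t + 2 ≤ 3 * Y ^ 3 := by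
      have hA : 2 * s * s * t ≤ 2 * Y * Y * Y := Nat.mul_le_mul (Nat.mul_le_mul (Nat.mul_le_mul_left 2 hs) hs) ht
      have hB : t + 2 ≤ Y := by omega
      have hC : Y ≤ Y * Y * Y := by
        calc Y = Y * 1 * 1 := by ring
          _ ≤ Y * Y * Y := Nat.mul_le_mul (Nat.mul_le_mul_left Y (by omega)) (by omega)
      calc t + 2 * s * s * t + 2 = (t + 2) + 2 * s * s * t := by ring
        _ ≤ Y * Y * Y + 2 * Y * Y * Y := Nat.add_le_add (hB.trans hC) hA
        _ = 3 * Y ^ 3 := by ring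
    have h2 : 3 * Y ^ 3 ≤ Y ^ 5 := by
      have : 3 ≤ Y * Y := by nlinarith
      calc 3 * Y ^ 3 ≤ (Y * Y) * Y ^ 3 := Nat.mul_le_mul_right _ this
        _ = Y ^ 5 := by ring
    exact h1.trans h2

/-- ★ `colLadder t n s ≤ (t + s + 2)^(colExp n)`. [folklore] -/
theorem colLadder_le_pow (t : ℕ) : ∀ n s : ℕ, colLadder t n s ≤ (t + s + 2) ^ colExp n
  | 0, s => by simp [colLadder, colExp]
  | n + 1, s => by
    set Y := t + s + 2 with hY
    have hY1 : 1 ≤ Y := by omega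
    obtain ⟨a1, a2⟩ := col_arith_step t s
    have ih := colLadder_le_pow t n (2 * s * s * t)
    have hrec : colLadder t n (2 * s * s * t) ≤ Y ^ (5 * colExp n) := by
      refine ih.trans ?_
      calc (t + 2 * s * s * t + 2) ^ colExp n ≤ (Y ^ 5) ^ colExp n := Nat.pow_le_pow_left a2 _
        _ = Y ^ (5 * colExp n) := by rw [← pow_mul]
    have hA : Y ^ 4 ≤ Y ^ (5 * colExp n + 4) := Nat.pow_le_pow_right hY1 (by omega)
    have hB : Y ^ (5 * colExp n) ≤ Y ^ (5 * colExp n + 4) := Nat.pow_le_pow_right hY1 (by omega)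
    have hC : 2 * Y ^ (5 * colExp n + 4) ≤ Y ^ (5 * colExp n + 5) := by
      rw [pow_succ]
      calc 2 * Y ^ (5 * colExp n + 4) = Y ^ (5 * colExp n + 4) * 2 := by ring
        _ ≤ Y ^ (5 * colExp n + 4) * Y := Nat.mul_le_mul_left _ (by omega)
    show colLadder t (n + 1) s ≤ Y ^ colExp (n + 1)
    simp only [colLadder, colExp]
    calc 3 * (t * t + t) + 3 * (s * s) + 3 + colLadder t n (2 * s * s * t) ≤ Y ^ 4 + Y ^ (5 * colExp n) := Nat.add_le_add a1 hrec
      _ ≤ Y ^ (5 * colExp n + 4) + Y ^ (5 * colExp n + 4) := Nat.add_le_add hA hB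
      _ = 2 * Y ^ (5 * colExp n + 4) := by ring
      _ ≤ Y ^ (5 * colExp n + 5) := hC

/-- `colBound K t ≤ (t+2)^(2·colExp K + 3)`. [folklore] -/
theorem colBound_le_pow (K t : ℕ) : colBound K t ≤ (t + 2) ^ (2 * colExp K + 3) := by
  unfold colBound
  have h1 : colLadder t K 1 ≤ (t + 2) ^ (2 * colExp K) := by
    refine (colLadder_le_pow t K 1).trans ?_
    calc (t + 1 + 2) ^ colExp K ≤ ((t + 2) ^ 2) ^ colExp K := Nat.pow_le_pow_left (by nlinarith) _
      _ = (t + 2) ^ (2 * colExp K) := by rw [← pow_mul]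
  have hX : 1 ≤ (t + 2) ^ (2 * colExp K) := Nat.one_le_pow _ _ (by omega)
  calc 2 * colLadder t K 1 + 4 ≤ 2 * (t + 2) ^ (2 * colExp K) + 4 := by omega
    _ ≤ 6 * (t + 2) ^ (2 * colExp K) := by omega
    _ ≤ (t + 2) ^ 3 * (t + 2) ^ (2 * colExp K) :=
        Nat.mul_le_mul_right _ (le_trans (by norm_num) (Nat.pow_le_pow_left (show 2 ≤ t + 2 by omega) 3))
    _ = (t + 2) ^ (2 * colExp K + 3) := by rw [← pow_add]; ring

/-- ★ **THE FIXED-`K` COLUMN LAW, readable currency:** for every number `K` of u-free columns there is `c = 2·colExp K + 3` such that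
`nv (Σ_{i∈I} X^{e_i}·ψ_i(u)) ≤ (t+2)^c` for all `t`-sparse `u`, all index sets `|I| ≤ K`, all exponents and all univariate columns —
uniform in the column heights (the u-degree).  A located CLASS of the OPEN `OLMLaw` slot; `OLMLaw` wants `c` independent of `K ~ m²`. -/
theorem olmColumnsLaw (K : ℕ) : ∃ c : ℕ, ∀ (t : ℕ) (u : Poly2), u.support.card ≤ t →
    ∀ {ι : Type} (I : Finset ι), I.card ≤ K → ∀ (e : ι → Expo) (ψ : ι → Polynomial ℂ),
      nv (∑ i ∈ I, monomial (e i) (1 : ℂ) * Polynomial.aeval u (ψ i)) ≤ (t + 2) ^ c :=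
  ⟨2 * colExp K + 3, fun t u hu _ I hI e ψ => (columnSum_nv_le K t u hu I hI e ψ).trans (colBound_le_pow K t)⟩

end TowerKernel

end Summit.ValiantsHypothesis.ValiantsHypothesis.Theorems.TwoProducts.RankTwoJacobian

end
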